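import Mathlib
import Summits.Ventures.HodgeRepro.Tier4.Common.LocalCoordinatesConj
import Summits.Ventures.HodgeRepro.Tier4.Line4.D3CoeffConj
import Summits.Ventures.HodgeRepro.Tier4.Line4.D3CoeffDelta
import Summits.Ventures.HodgeRepro.Tier4.Line4.D3CoeffDecayDefinite
import Summits.Ventures.HodgeRepro.Tier4.Line4.DefiniteCoeff
import Summits.Ventures.HodgeRepro.Tier4.Line4.DetTwist
import Summits.Ventures.HodgeRepro.Tier4.Line4.D3CoeffGeneral

/-!
# Tier4/Line4/ArchProdCoeff — C-L4-ARCHPROD: the PRODUCT archimedean witness over the infinite places,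
`archProd f₀ := f₀ · ∏_{w′ ≠ w₀} defCoeff w′ (eP′ w′) (eM′ w′)`, with the FULL `equiv` clause of `IsArchCoeff` at EVERY
place, continuity, the bound `‖archProd f₀‖ ≤ ‖f₀‖` and the inherited weight-3 decay; instantiated at the two general
`w₀`-factors `d3Gen (eM′ w₀)` / `d3Gen' (eP′ w₀)` (`archWitness` / `archWitness'`)

Blind re-derivation cell `pub-hodge-repro`, Tier 4 (README §9–§10), seat t4-L1-p5 (prover, gen 5; S15149 NEXT =
C-L4-ARCHPROD; plan-4 S15084 (a)(b)).  Target tree path `lean/Summits/Ventures/HodgeRepro/Tier4/Line4/ArchProdCoeff.lean`.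
On the seat's `DefiniteCoeff` (p703816), `DetTwist`, `D3CoeffGeneral`, `D3CoeffDecayDefinite` (p702693:
`hasDecay3_D3coeff'_of_definite`), `D3CoeffConj` (p700675), `D3CoeffDelta` (p702993); no printed input.

THE OBJECT.  Let `W` be the seesaw plane, `w₀` the indefinite real CM place, `eP′ eM′ : InfinitePlace k → ℤ` the DISPLAYED
weight functions of display (7a) (LINE L4 v0.34 L1145).  **`defCoeffProd w₀ eP′ eM′ x := ∏_{w′ ∈ univ.erase w₀} defCoeff w′
(eP′ w′) (eM′ w′) x`** (the definite-place factors; each reads the `w′`-block only) and **`archProd f₀ := f₀ · defCoeffProd`**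
for a `w₀`-factor `f₀`.  The two witnesses of (7a) are `archWitness := archProd (d3Gen w₀ (eM′ w₀))` (the branch
`eP′ w₀ = eM′ w₀ + 3`) and `archWitness' := archProd (d3Gen' w₀ (eP′ w₀))` (the branch `eM′ w₀ = eP′ w₀ + 3`) — together
they cover EVERY displayed pair with `eP′ w₀ − eM′ w₀ = ±3` (`_he'`).

WHAT IS PROVED (kernel, no print; every statement with the explicit hypotheses it needs):
* `defCoeffProd_one`, `continuous_defCoeffProd`, **`norm_defCoeffProd_le_one`** (definite at every `w′ ≠ w₀`),
  `defCoeffProd_mul_of_mem_localTorusAt'_base` (`T′_{w₀}` acts trivially on the definite factors),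
  **`cj_defCoeffProd_inv_mul`** (the `equiv` law of the definite product at every `w ≠ w₀`: the `w`-factor's law
  `cj_defCoeff_inv_mul` × the triviality of the other factors);
* `archProd_apply`, `continuous_archProd`, **`norm_archProd_le`** (`≤ ‖f₀ x‖`), **`decay_archProd`** (the weight-3 decay
  bound of `f₀` — in the `archDist` form of `HasDecay3` — is a decay bound of `archProd f₀`),
  **`cj_archProd_inv_mul`** — THE `equiv` FIELD OF `IsArchCoeff` AT EVERY PLACE for `archProd f₀`, from the law of `f₀` at
  `w₀` and its triviality at `w ≠ w₀` (the case split `w = w₀` / `w ≠ w₀`);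
* the instantiations **`cj_archWitness_inv_mul`** (`he : eP′ w₀ = eM′ w₀ + 3`) and **`cj_archWitness'_inv_mul`**
  (`he : eM′ w₀ = eP′ w₀ + 3`) — `∀ w κ, κ ∈ localTorusAt' W w → ∀ y, cj F (κ⁻¹ y) = weightAt' … 0 κ ^ (−eP′ w) ·
  weightAt' … 1 κ ^ (−eM′ w) · cj F y`, the clause VERBATIM; `continuous_archWitness` / `continuous_archWitness'`;
  **`decay_archWitness` / `decay_archWitness'`** when `w₀` is the only indefinite place (`U(1,1)` signs at `w₀`, definite
  at every `w′ ≠ w₀`): `∃ C, ∀ x, ‖F x‖ ≤ C · exp (−(3 · ∑_{w′} log (max 1 (∑ᵢⱼ ‖adToC w′ (mat x i j)‖))))` — the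
  `decay` field of `IsArchCoeffD` in its unfolded form (`archDist` = that sum).

STATUS OF THE (7a) WITNESS after this module (the fields of `IsArchCoeffD`): `cont` ✓, `equiv` ✓ (all places, all
displayed weights), `decay` ✓ (when `w₀` is the only indefinite place; else `D3coeff' ⊗ bump`, p701824),
`infOnly` (by name once the `locEntry'`-level law of `GA.ofInfPart` lands — L4-p1 g4's C-L4-INFONLY), `integrable`
(modulo the `G_∞`-integrability input `hD3inf`, L4-p1's ProdFnIntegrable p701176), `arch_ne` (displayed: the
`w₀`-Fourier coefficient + the definite-place twisted integrals), `pseudo` / `pseudo'` (displayed: operator Schur).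
Nothing here says anything about the status of the Hodge conjecture for CM abelian varieties, which is NOT proved
(HC_CM is NOT proved by anyone in this repository).
-/

set_option autoImplicit false

noncomputable section

namespace Summit.Ventures.HodgeRepro.Tier4.Line4

open Summit.Ventures.HodgeRepro.Tier4.Common Summit.Ventures.HodgeRepro.Tier4.Line1 NumberField Matrix

open scoped ComplexConjugate

open scoped Classical
section Prod

variable {k : Type} [Field k] [NumberField k] (q : QuadData k) (a : Fin 4 → k)
  (g g' : Matrix (Fin 4) (Fin 4) k) (hgg' : g * g' = 1) (hg'g : g' * g = 1)
  (hgΩ : g * (PlaneData.mixedRow q (a 0) (a 2)).Ω = (PlaneData.mixedRow q (a 0) (a 2)).Ω * g)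
  (lam : k) (hlam : lam ≠ 0)
  (hiso : g * (PlaneData.mixedRow q (a 1) (a 3)).B * gᵀ = lam • (PlaneData.mixedRow q (a 0) (a 2)).B)
  (w₀ : InfinitePlace k) (eP' eM' : InfinitePlace k → ℤ)

/-- **the product of the definite-place factors** over the places `w′ ≠ w₀`:
`∏_{w′ ≠ w₀} defCoeff w′ (eP′ w′) (eM′ w′) x`. -/
def defCoeffProd (x : GA ((PlaneData.mixedRow q (a 0) (a 2)).withTransportedTorus g g' hgg' hg'g hgΩ)) : ℂ :=
  ∏ w' ∈ Finset.univ.erase w₀, defCoeff q a g g' hgg' hg'g hgΩ lam hiso w' (eP' w') (eM' w') x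

/-- `defCoeffProd 1 = 1`. -/
theorem defCoeffProd_one : defCoeffProd q a g g' hgg' hg'g hgΩ lam hiso w₀ eP' eM' 1 = 1 := by
  unfold defCoeffProd
  exact Finset.prod_eq_one fun w' _ => defCoeff_one q a g g' hgg' hg'g hgΩ lam hiso w' _ _

/-- `defCoeffProd` is continuous. -/
theorem continuous_defCoeffProd : Continuous (defCoeffProd q a g g' hgg' hg'g hgΩ lam hiso w₀ eP' eM') :=
  continuous_finsetProd _ fun w' _ => continuous_defCoeff q a g g' hgg' hg'g hgΩ lam hiso w' _ _

/-- **`‖defCoeffProd x‖ ≤ 1`** when every place `w′ ≠ w₀` is a DEFINITE real CM place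
(`(a 1)_{w′} · (−a 3)_{w′} > 0`). -/
theorem norm_defCoeffProd_le_one
    (hdef : ∀ w' : InfinitePlace k, w' ≠ w₀ → w'.IsReal ∧ IsCMAt q w' ∧
      0 < (adToC w' (algebraMap k (Ad k) (a 1))).re * (adToC w' (algebraMap k (Ad k) (-1 * a 3))).re)
    (x : GA ((PlaneData.mixedRow q (a 0) (a 2)).withTransportedTorus g g' hgg' hg'g hgΩ)) :
    ‖defCoeffProd q a g g' hgg' hg'g hgΩ lam hiso w₀ eP' eM' x‖ ≤ 1 := by
  unfold defCoeffProd
  rw [norm_prod]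
  refine Finset.prod_le_one (fun _ _ => norm_nonneg _) fun w' hw' => ?_
  obtain ⟨hr, hcm, hd⟩ := hdef w' (Finset.ne_of_mem_erase hw')
  exact norm_defCoeff_le_one q a g g' hgg' hg'g hgΩ lam hiso w' hr hcm hd _ _ x

include hlam in
/-- **`T′_{w₀}` acts trivially on the definite factors**: for `κ ∈ localTorusAt' W w₀`,
`defCoeffProd (κ x) = defCoeffProd x` (each factor reads a block `w′ ≠ w₀`). -/
theorem defCoeffProd_mul_of_mem_localTorusAt'_base
    (hdef : ∀ w' : InfinitePlace k, w' ≠ w₀ → w'.IsReal ∧ IsCMAt q w')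
    {κ : GA ((PlaneData.mixedRow q (a 0) (a 2)).withTransportedTorus g g' hgg' hg'g hgΩ)}
    (hκ : κ ∈ localTorusAt' ((PlaneData.mixedRow q (a 0) (a 2)).withTransportedTorus g g' hgg' hg'g hgΩ) w₀)
    (x : GA ((PlaneData.mixedRow q (a 0) (a 2)).withTransportedTorus g g' hgg' hg'g hgΩ)) :
    defCoeffProd q a g g' hgg' hg'g hgΩ lam hiso w₀ eP' eM' (κ * x) =
      defCoeffProd q a g g' hgg' hg'g hgΩ lam hiso w₀ eP' eM' x := by
  unfold defCoeffProd
  refine Finset.prod_congr rfl fun w' hw' => ?_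
  obtain ⟨hr, hcm⟩ := hdef w' (Finset.ne_of_mem_erase hw')
  exact defCoeff_mul_of_mem_localTorusAt'_ne q a g g' hgg' hg'g hgΩ lam hlam hiso w' hr hcm
    (Finset.ne_of_mem_erase hw').symm _ _ hκ x

include hlam in
/-- **THE `equiv` LAW OF THE DEFINITE PRODUCT at a place `w ≠ w₀`**: for `κ ∈ localTorusAt' W w` and every `y`,
`RTF.cj defCoeffProd (κ⁻¹ y) = weightAt' … 0 κ ^ (−eP′ w) · weightAt' … 1 κ ^ (−eM′ w) · RTF.cj defCoeffProd y`
(the `w`-factor's `cj_defCoeff_inv_mul`; the factors at `w′ ≠ w` are untouched by `T′_w`). -/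
theorem cj_defCoeffProd_inv_mul
    (hdef : ∀ w' : InfinitePlace k, w' ≠ w₀ → w'.IsReal ∧ IsCMAt q w') (ha1 : a 1 ≠ 0) (ha3 : a 3 ≠ 0)
    {w : InfinitePlace k} (hw : w ≠ w₀)
    {κ : GA ((PlaneData.mixedRow q (a 0) (a 2)).withTransportedTorus g g' hgg' hg'g hgΩ)}
    (hκ : κ ∈ localTorusAt' ((PlaneData.mixedRow q (a 0) (a 2)).withTransportedTorus g g' hgg' hg'g hgΩ) w)
    (y : GA ((PlaneData.mixedRow q (a 0) (a 2)).withTransportedTorus g g' hgg' hg'g hgΩ)) :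
    RTF.cj (defCoeffProd q a g g' hgg' hg'g hgΩ lam hiso w₀ eP' eM') (κ⁻¹ * y) =
      weightAt' ((PlaneData.mixedRow q (a 0) (a 2)).withTransportedTorus g g' hgg' hg'g hgΩ) q w g g' 0 κ ^ (-eP' w) *
        weightAt' ((PlaneData.mixedRow q (a 0) (a 2)).withTransportedTorus g g' hgg' hg'g hgΩ) q w g g' 1 κ ^ (-eM' w) *
        RTF.cj (defCoeffProd q a g g' hgg' hg'g hgΩ lam hiso w₀ eP' eM') y := by
  obtain ⟨hwr, hwcm⟩ := hdef w hw
  have hκ' : κ⁻¹ ∈ localTorusAt' ((PlaneData.mixedRow q (a 0) (a 2)).withTransportedTorus g g' hgg' hg'g hgΩ) w :=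
    (localTorusAt' _ w).inv_mem hκ
  have hws : w ∈ (Finset.univ : Finset (InfinitePlace k)).erase w₀ := Finset.mem_erase.2 ⟨hw, Finset.mem_univ w⟩
  set F : InfinitePlace k → GA ((PlaneData.mixedRow q (a 0) (a 2)).withTransportedTorus g g' hgg' hg'g hgΩ) → ℂ :=
    fun w' => defCoeff q a g g' hgg' hg'g hgΩ lam hiso w' (eP' w') (eM' w') with hF
  have hsplit : ∀ z, ∏ w' ∈ (Finset.univ : Finset (InfinitePlace k)).erase w₀, F w' z =
      F w z * ∏ w' ∈ ((Finset.univ : Finset (InfinitePlace k)).erase w₀).erase w, F w' z :=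
    fun z => (Finset.mul_prod_erase _ (fun w' => F w' z) hws).symm
  have htriv : ∏ w' ∈ ((Finset.univ : Finset (InfinitePlace k)).erase w₀).erase w, F w' (κ⁻¹ * y) =
      ∏ w' ∈ ((Finset.univ : Finset (InfinitePlace k)).erase w₀).erase w, F w' y := by
    refine Finset.prod_congr rfl fun w' hw' => ?_
    obtain ⟨hr, hcm⟩ := hdef w' (Finset.ne_of_mem_erase (Finset.mem_of_mem_erase hw'))
    exact defCoeff_mul_of_mem_localTorusAt'_ne q a g g' hgg' hg'g hgΩ lam hlam hiso w' hr hcm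
      (Finset.ne_of_mem_erase hw').symm _ _ hκ' y
  have hlaw := cj_defCoeff_inv_mul q a g g' hgg' hg'g hgΩ lam hlam hiso w hwr hwcm ha1 ha3 (eP' w) (eM' w) hκ y
  simp only [RTF.cj] at hlaw ⊢
  unfold defCoeffProd
  rw [hsplit, hsplit y, htriv, map_mul, map_mul, hlaw]
  ring

/-- **the archimedean witness from a `w₀`-factor** `f₀`: `archProd f₀ := f₀ · defCoeffProd` (pointwise). -/
def archProd (f₀ : GA ((PlaneData.mixedRow q (a 0) (a 2)).withTransportedTorus g g' hgg' hg'g hgΩ) → ℂ) :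
    GA ((PlaneData.mixedRow q (a 0) (a 2)).withTransportedTorus g g' hgg' hg'g hgΩ) → ℂ :=
  f₀ * defCoeffProd q a g g' hgg' hg'g hgΩ lam hiso w₀ eP' eM'

/-- `archProd f₀ x = f₀ x * defCoeffProd x` (`rfl`). -/
theorem archProd_apply (f₀ : GA ((PlaneData.mixedRow q (a 0) (a 2)).withTransportedTorus g g' hgg' hg'g hgΩ) → ℂ)
    (x : GA ((PlaneData.mixedRow q (a 0) (a 2)).withTransportedTorus g g' hgg' hg'g hgΩ)) :
    archProd q a g g' hgg' hg'g hgΩ lam hiso w₀ eP' eM' f₀ x =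
      f₀ x * defCoeffProd q a g g' hgg' hg'g hgΩ lam hiso w₀ eP' eM' x := rfl

/-- `archProd f₀` is continuous when `f₀` is. -/
theorem continuous_archProd {f₀ : GA ((PlaneData.mixedRow q (a 0) (a 2)).withTransportedTorus g g' hgg' hg'g hgΩ) → ℂ}
    (hf : Continuous f₀) : Continuous (archProd q a g g' hgg' hg'g hgΩ lam hiso w₀ eP' eM' f₀) :=
  hf.mul (continuous_defCoeffProd q a g g' hgg' hg'g hgΩ lam hiso w₀ eP' eM')

/-- **`‖archProd f₀ x‖ ≤ ‖f₀ x‖`** (definite at every `w′ ≠ w₀`). -/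
theorem norm_archProd_le
    (hdef : ∀ w' : InfinitePlace k, w' ≠ w₀ → w'.IsReal ∧ IsCMAt q w' ∧
      0 < (adToC w' (algebraMap k (Ad k) (a 1))).re * (adToC w' (algebraMap k (Ad k) (-1 * a 3))).re)
    (f₀ : GA ((PlaneData.mixedRow q (a 0) (a 2)).withTransportedTorus g g' hgg' hg'g hgΩ) → ℂ)
    (x : GA ((PlaneData.mixedRow q (a 0) (a 2)).withTransportedTorus g g' hgg' hg'g hgΩ)) :
    ‖archProd q a g g' hgg' hg'g hgΩ lam hiso w₀ eP' eM' f₀ x‖ ≤ ‖f₀ x‖ := by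
  rw [archProd_apply, norm_mul]
  exact mul_le_of_le_one_right (norm_nonneg _)
    (norm_defCoeffProd_le_one q a g g' hgg' hg'g hgΩ lam hiso w₀ eP' eM' hdef x)

/-- **the weight-3 decay transfers** from the `w₀`-factor to `archProd f₀` (the `decay` field of `IsArchCoeffD` in its
unfolded `archDist` form). -/
theorem decay_archProd
    (hdef : ∀ w' : InfinitePlace k, w' ≠ w₀ → w'.IsReal ∧ IsCMAt q w' ∧
      0 < (adToC w' (algebraMap k (Ad k) (a 1))).re * (adToC w' (algebraMap k (Ad k) (-1 * a 3))).re)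
    {f₀ : GA ((PlaneData.mixedRow q (a 0) (a 2)).withTransportedTorus g g' hgg' hg'g hgΩ) → ℂ}
    (hf : ∃ C : ℝ, ∀ x : GA ((PlaneData.mixedRow q (a 0) (a 2)).withTransportedTorus g g' hgg' hg'g hgΩ),
      ‖f₀ x‖ ≤ C * Real.exp (-(3 * ∑ w' : InfinitePlace k, Real.log (max 1 (∑ i : Fin 4, ∑ j : Fin 4,
        ‖adToC w' (GA.mat ((PlaneData.mixedRow q (a 0) (a 2)).withTransportedTorus g g' hgg' hg'g hgΩ) x i j)‖))))) :
    ∃ C : ℝ, ∀ x : GA ((PlaneData.mixedRow q (a 0) (a 2)).withTransportedTorus g g' hgg' hg'g hgΩ),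
      ‖archProd q a g g' hgg' hg'g hgΩ lam hiso w₀ eP' eM' f₀ x‖ ≤
        C * Real.exp (-(3 * ∑ w' : InfinitePlace k, Real.log (max 1 (∑ i : Fin 4, ∑ j : Fin 4,
          ‖adToC w' (GA.mat ((PlaneData.mixedRow q (a 0) (a 2)).withTransportedTorus g g' hgg' hg'g hgΩ) x i j)‖)))) := by
  obtain ⟨C, hC⟩ := hf
  exact ⟨C, fun x => (norm_archProd_le q a g g' hgg' hg'g hgΩ lam hiso w₀ eP' eM' hdef f₀ x).trans (hC x)⟩

include hlam in
/-- **THE `equiv` FIELD OF `IsArchCoeff` AT EVERY PLACE for `archProd f₀`**, from the law of `f₀` at `w₀` and its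
triviality under `T′_w`, `w ≠ w₀`: for every place `w`, `κ ∈ localTorusAt' W w` and `y`,
`RTF.cj (archProd f₀) (κ⁻¹ y) = weightAt' … 0 κ ^ (−eP′ w) · weightAt' … 1 κ ^ (−eM′ w) · RTF.cj (archProd f₀) y`. -/
theorem cj_archProd_inv_mul
    (hdef : ∀ w' : InfinitePlace k, w' ≠ w₀ → w'.IsReal ∧ IsCMAt q w') (ha1 : a 1 ≠ 0) (ha3 : a 3 ≠ 0)
    {f₀ : GA ((PlaneData.mixedRow q (a 0) (a 2)).withTransportedTorus g g' hgg' hg'g hgΩ) → ℂ}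
    (hf₀ : ∀ κ : GA ((PlaneData.mixedRow q (a 0) (a 2)).withTransportedTorus g g' hgg' hg'g hgΩ),
      κ ∈ localTorusAt' ((PlaneData.mixedRow q (a 0) (a 2)).withTransportedTorus g g' hgg' hg'g hgΩ) w₀ →
      ∀ y, RTF.cj f₀ (κ⁻¹ * y) =
        weightAt' ((PlaneData.mixedRow q (a 0) (a 2)).withTransportedTorus g g' hgg' hg'g hgΩ) q w₀ g g' 0 κ ^ (-eP' w₀) *
          weightAt' ((PlaneData.mixedRow q (a 0) (a 2)).withTransportedTorus g g' hgg' hg'g hgΩ) q w₀ g g' 1 κ ^ (-eM' w₀) *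
          RTF.cj f₀ y)
    (hf₀triv : ∀ w : InfinitePlace k, w ≠ w₀ →
      ∀ κ : GA ((PlaneData.mixedRow q (a 0) (a 2)).withTransportedTorus g g' hgg' hg'g hgΩ),
      κ ∈ localTorusAt' ((PlaneData.mixedRow q (a 0) (a 2)).withTransportedTorus g g' hgg' hg'g hgΩ) w →
      ∀ x, f₀ (κ * x) = f₀ x)
    (w : InfinitePlace k) (κ : GA ((PlaneData.mixedRow q (a 0) (a 2)).withTransportedTorus g g' hgg' hg'g hgΩ))
    (hκ : κ ∈ localTorusAt' ((PlaneData.mixedRow q (a 0) (a 2)).withTransportedTorus g g' hgg' hg'g hgΩ) w)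
    (y : GA ((PlaneData.mixedRow q (a 0) (a 2)).withTransportedTorus g g' hgg' hg'g hgΩ)) :
    RTF.cj (archProd q a g g' hgg' hg'g hgΩ lam hiso w₀ eP' eM' f₀) (κ⁻¹ * y) =
      weightAt' ((PlaneData.mixedRow q (a 0) (a 2)).withTransportedTorus g g' hgg' hg'g hgΩ) q w g g' 0 κ ^ (-eP' w) *
        weightAt' ((PlaneData.mixedRow q (a 0) (a 2)).withTransportedTorus g g' hgg' hg'g hgΩ) q w g g' 1 κ ^ (-eM' w) *
        RTF.cj (archProd q a g g' hgg' hg'g hgΩ lam hiso w₀ eP' eM' f₀) y := by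
  have hκ' : κ⁻¹ ∈ localTorusAt' ((PlaneData.mixedRow q (a 0) (a 2)).withTransportedTorus g g' hgg' hg'g hgΩ) w :=
    (localTorusAt' _ w).inv_mem hκ
  by_cases hw : w = w₀
  · subst hw
    have h1 := hf₀ κ hκ y
    have h2 := defCoeffProd_mul_of_mem_localTorusAt'_base q a g g' hgg' hg'g hgΩ lam hlam hiso w eP' eM' hdef hκ' y
    simp only [RTF.cj, archProd, Pi.mul_apply] at h1 ⊢
    rw [h2, map_mul, map_mul, h1]
    ring
  · have h1 := hf₀triv w hw κ⁻¹ hκ' y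
    have h2 := cj_defCoeffProd_inv_mul q a g g' hgg' hg'g hgΩ lam hlam hiso w₀ eP' eM' hdef ha1 ha3 hw hκ y
    simp only [RTF.cj, archProd, Pi.mul_apply] at h2 ⊢
    rw [h1, map_mul, map_mul, h2]
    ring

end Prod

section Witness

variable {k : Type} [Field k] [NumberField k] (q : QuadData k) (a : Fin 4 → k)
  (g g' : Matrix (Fin 4) (Fin 4) k) (hgg' : g * g' = 1) (hg'g : g' * g = 1)
  (hgΩ : g * (PlaneData.mixedRow q (a 0) (a 2)).Ω = (PlaneData.mixedRow q (a 0) (a 2)).Ω * g)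
  (lam : k) (hlam : lam ≠ 0)
  (hiso : g * (PlaneData.mixedRow q (a 1) (a 3)).B * gᵀ = lam • (PlaneData.mixedRow q (a 0) (a 2)).B)
  (w₀ : InfinitePlace k) (eP' eM' : InfinitePlace k → ℤ)

/-- **the archimedean witness, holomorphic branch** (`eP′ w₀ = eM′ w₀ + 3`):
`archProd (d3Gen w₀ (eM′ w₀)) = D3coeff' · detTwist (eM′ w₀) · ∏_{w′ ≠ w₀} defCoeff w′ (eP′ w′) (eM′ w′)`. -/
def archWitness : GA ((PlaneData.mixedRow q (a 0) (a 2)).withTransportedTorus g g' hgg' hg'g hgΩ) → ℂ :=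
  archProd q a g g' hgg' hg'g hgΩ lam hiso w₀ eP' eM' (d3Gen q a g g' hgg' hg'g hgΩ lam hiso w₀ (eM' w₀))

/-- **the archimedean witness, antiholomorphic branch** (`eM′ w₀ = eP′ w₀ + 3`):
`archProd (d3Gen' w₀ (eP′ w₀)) = D3coeff'' · detTwist (eP′ w₀) · ∏_{w′ ≠ w₀} defCoeff w′ (eP′ w′) (eM′ w′)`. -/
def archWitness' : GA ((PlaneData.mixedRow q (a 0) (a 2)).withTransportedTorus g g' hgg' hg'g hgΩ) → ℂ :=
  archProd q a g g' hgg' hg'g hgΩ lam hiso w₀ eP' eM' (d3Gen' q a g g' hgg' hg'g hgΩ lam hiso w₀ (eP' w₀))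

/-- `archWitness` is continuous (`U(1,1)` signs at `w₀`). -/
theorem continuous_archWitness (hw₀ : w₀.IsReal) (hcm₀ : IsCMAt q w₀)
    (ha1 : 0 < (adToC w₀ (algebraMap k (Ad k) (a 1))).re) (ha3 : (adToC w₀ (algebraMap k (Ad k) (-1 * a 3))).re < 0) :
    Continuous (archWitness q a g g' hgg' hg'g hgΩ lam hiso w₀ eP' eM') :=
  continuous_archProd q a g g' hgg' hg'g hgΩ lam hiso w₀ eP' eM'
    (continuous_d3Gen q a g g' hgg' hg'g hgΩ lam hiso w₀ hw₀ hcm₀ ha1 ha3 _)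

/-- `archWitness'` is continuous (`U(1,1)` signs at `w₀`). -/
theorem continuous_archWitness' (hw₀ : w₀.IsReal) (hcm₀ : IsCMAt q w₀)
    (ha1 : 0 < (adToC w₀ (algebraMap k (Ad k) (a 1))).re) (ha3 : (adToC w₀ (algebraMap k (Ad k) (-1 * a 3))).re < 0) :
    Continuous (archWitness' q a g g' hgg' hg'g hgΩ lam hiso w₀ eP' eM') :=
  continuous_archProd q a g g' hgg' hg'g hgΩ lam hiso w₀ eP' eM'
    (continuous_d3Gen' q a g g' hgg' hg'g hgΩ lam hiso w₀ hw₀ hcm₀ ha1 ha3 _)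

include hlam in
/-- **THE `equiv` FIELD FOR `archWitness` AT EVERY PLACE** (`he : eP′ w₀ = eM′ w₀ + 3`): for every `w`, `κ ∈ localTorusAt' W w`
and `y`, `RTF.cj archWitness (κ⁻¹ y) = weightAt' … 0 κ ^ (−eP′ w) · weightAt' … 1 κ ^ (−eM′ w) · RTF.cj archWitness y`. -/
theorem cj_archWitness_inv_mul (hw₀ : w₀.IsReal) (hcm₀ : IsCMAt q w₀) (ha1 : a 1 ≠ 0) (ha3 : a 3 ≠ 0)
    (hdef : ∀ w' : InfinitePlace k, w' ≠ w₀ → w'.IsReal ∧ IsCMAt q w') (he : eP' w₀ = eM' w₀ + 3)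
    (w : InfinitePlace k) (κ : GA ((PlaneData.mixedRow q (a 0) (a 2)).withTransportedTorus g g' hgg' hg'g hgΩ))
    (hκ : κ ∈ localTorusAt' ((PlaneData.mixedRow q (a 0) (a 2)).withTransportedTorus g g' hgg' hg'g hgΩ) w)
    (y : GA ((PlaneData.mixedRow q (a 0) (a 2)).withTransportedTorus g g' hgg' hg'g hgΩ)) :
    RTF.cj (archWitness q a g g' hgg' hg'g hgΩ lam hiso w₀ eP' eM') (κ⁻¹ * y) =
      weightAt' ((PlaneData.mixedRow q (a 0) (a 2)).withTransportedTorus g g' hgg' hg'g hgΩ) q w g g' 0 κ ^ (-eP' w) *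
        weightAt' ((PlaneData.mixedRow q (a 0) (a 2)).withTransportedTorus g g' hgg' hg'g hgΩ) q w g g' 1 κ ^ (-eM' w) *
        RTF.cj (archWitness q a g g' hgg' hg'g hgΩ lam hiso w₀ eP' eM') y :=
  cj_archProd_inv_mul q a g g' hgg' hg'g hgΩ lam hlam hiso w₀ eP' eM' hdef ha1 ha3
    (fun _ hκ y => cj_d3Gen_inv_mul' q a g g' hgg' hg'g hgΩ lam hlam hiso w₀ hw₀ hcm₀ ha1 ha3 he hκ y)
    (fun _ hw _ hκ x =>
      d3Gen_mul_of_mem_localTorusAt'_ne q a g g' hgg' hg'g hgΩ lam hlam hiso w₀ hw₀ hcm₀ hw _ hκ x)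
    w κ hκ y

include hlam in
/-- **THE `equiv` FIELD FOR `archWitness'` AT EVERY PLACE** (`he : eM′ w₀ = eP′ w₀ + 3`). -/
theorem cj_archWitness'_inv_mul (hw₀ : w₀.IsReal) (hcm₀ : IsCMAt q w₀) (ha1 : a 1 ≠ 0) (ha3 : a 3 ≠ 0)
    (hdef : ∀ w' : InfinitePlace k, w' ≠ w₀ → w'.IsReal ∧ IsCMAt q w') (he : eM' w₀ = eP' w₀ + 3)
    (w : InfinitePlace k) (κ : GA ((PlaneData.mixedRow q (a 0) (a 2)).withTransportedTorus g g' hgg' hg'g hgΩ))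
    (hκ : κ ∈ localTorusAt' ((PlaneData.mixedRow q (a 0) (a 2)).withTransportedTorus g g' hgg' hg'g hgΩ) w)
    (y : GA ((PlaneData.mixedRow q (a 0) (a 2)).withTransportedTorus g g' hgg' hg'g hgΩ)) :
    RTF.cj (archWitness' q a g g' hgg' hg'g hgΩ lam hiso w₀ eP' eM') (κ⁻¹ * y) =
      weightAt' ((PlaneData.mixedRow q (a 0) (a 2)).withTransportedTorus g g' hgg' hg'g hgΩ) q w g g' 0 κ ^ (-eP' w) *
        weightAt' ((PlaneData.mixedRow q (a 0) (a 2)).withTransportedTorus g g' hgg' hg'g hgΩ) q w g g' 1 κ ^ (-eM' w) *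
        RTF.cj (archWitness' q a g g' hgg' hg'g hgΩ lam hiso w₀ eP' eM') y :=
  cj_archProd_inv_mul q a g g' hgg' hg'g hgΩ lam hlam hiso w₀ eP' eM' hdef ha1 ha3
    (fun _ hκ y => cj_d3Gen'_inv_mul' q a g g' hgg' hg'g hgΩ lam hlam hiso w₀ hw₀ hcm₀ ha1 ha3 he hκ y)
    (fun _ hw _ hκ x =>
      d3Gen'_mul_of_mem_localTorusAt'_ne q a g g' hgg' hg'g hgΩ lam hlam hiso w₀ hw₀ hcm₀ hw _ hκ x)
    w κ hκ y

include hlam in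
/-- **THE WEIGHT-3 DECAY OF `archWitness`** when `w₀` is the only indefinite place (`U(1,1)` signs at `w₀`, DEFINITE at
every real CM place `w′ ≠ w₀`): `∃ C, ∀ x, ‖archWitness x‖ ≤ C · exp (−(3 · ∑_{w′} log (max 1 (∑ᵢⱼ ‖adToC w′ (mat x i j)‖))))`
— the `decay` field of `IsArchCoeffD` (`archDist` unfolded), from `hasDecay3_D3coeff'_of_definite` (p702693) through
`norm_d3Gen_le` and `norm_archProd_le`. -/
theorem decay_archWitness (hw₀ : w₀.IsReal) (hcm₀ : IsCMAt q w₀)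
    (ha1 : 0 < (adToC w₀ (algebraMap k (Ad k) (a 1))).re) (ha3 : (adToC w₀ (algebraMap k (Ad k) (-1 * a 3))).re < 0)
    (hdef : ∀ w' : InfinitePlace k, w' ≠ w₀ → w'.IsReal ∧ IsCMAt q w' ∧
      0 < (adToC w' (algebraMap k (Ad k) (a 1))).re * (adToC w' (algebraMap k (Ad k) (-1 * a 3))).re) :
    ∃ C : ℝ, ∀ x : GA ((PlaneData.mixedRow q (a 0) (a 2)).withTransportedTorus g g' hgg' hg'g hgΩ),
      ‖archWitness q a g g' hgg' hg'g hgΩ lam hiso w₀ eP' eM' x‖ ≤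
        C * Real.exp (-(3 * ∑ w' : InfinitePlace k, Real.log (max 1 (∑ i : Fin 4, ∑ j : Fin 4,
          ‖adToC w' (GA.mat ((PlaneData.mixedRow q (a 0) (a 2)).withTransportedTorus g g' hgg' hg'g hgΩ) x i j)‖)))) := by
  have hA : adToC w₀ (algebraMap k (Ad k) (a 1)) ≠ 0 := fun h => by rw [h] at ha1; simp at ha1
  have hB : adToC w₀ (algebraMap k (Ad k) (-1 * a 3)) ≠ 0 := fun h => by rw [h] at ha3; simp at ha3
  obtain ⟨C, hC⟩ := hasDecay3_D3coeff'_of_definite q a g g' hgg' hg'g hgΩ lam hlam hiso w₀ hw₀ hcm₀ ha1 ha3 hdef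
  refine decay_archProd q a g g' hgg' hg'g hgΩ lam hiso w₀ eP' eM' hdef ⟨C, fun x => ?_⟩
  exact (norm_d3Gen_le q a g g' hgg' hg'g hgΩ lam hiso w₀ hw₀ hcm₀ hA hB _ x).trans (hC x)

include hlam in
/-- **THE WEIGHT-3 DECAY OF `archWitness'`** under the same hypotheses (`‖D3coeff''‖ = ‖D3coeff'‖`). -/
theorem decay_archWitness' (hw₀ : w₀.IsReal) (hcm₀ : IsCMAt q w₀)
    (ha1 : 0 < (adToC w₀ (algebraMap k (Ad k) (a 1))).re) (ha3 : (adToC w₀ (algebraMap k (Ad k) (-1 * a 3))).re < 0)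
    (hdef : ∀ w' : InfinitePlace k, w' ≠ w₀ → w'.IsReal ∧ IsCMAt q w' ∧
      0 < (adToC w' (algebraMap k (Ad k) (a 1))).re * (adToC w' (algebraMap k (Ad k) (-1 * a 3))).re) :
    ∃ C : ℝ, ∀ x : GA ((PlaneData.mixedRow q (a 0) (a 2)).withTransportedTorus g g' hgg' hg'g hgΩ),
      ‖archWitness' q a g g' hgg' hg'g hgΩ lam hiso w₀ eP' eM' x‖ ≤
        C * Real.exp (-(3 * ∑ w' : InfinitePlace k, Real.log (max 1 (∑ i : Fin 4, ∑ j : Fin 4,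
          ‖adToC w' (GA.mat ((PlaneData.mixedRow q (a 0) (a 2)).withTransportedTorus g g' hgg' hg'g hgΩ) x i j)‖)))) := by
  have hA : adToC w₀ (algebraMap k (Ad k) (a 1)) ≠ 0 := fun h => by rw [h] at ha1; simp at ha1
  have hB : adToC w₀ (algebraMap k (Ad k) (-1 * a 3)) ≠ 0 := fun h => by rw [h] at ha3; simp at ha3
  obtain ⟨C, hC⟩ := hasDecay3_D3coeff'_of_definite q a g g' hgg' hg'g hgΩ lam hlam hiso w₀ hw₀ hcm₀ ha1 ha3 hdef
  refine decay_archProd q a g g' hgg' hg'g hgΩ lam hiso w₀ eP' eM' hdef ⟨C, fun x => ?_⟩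
  refine (norm_d3Gen'_le q a g g' hgg' hg'g hgΩ lam hiso w₀ hw₀ hcm₀ hA hB _ x).trans ?_
  rw [norm_D3coeff''_eq_norm_D3coeff' q a g g' hgg' hg'g hgΩ lam hiso w₀ hw₀ hcm₀ ha1 ha3 x]
  exact hC x

end Witness

end Summit.Ventures.HodgeRepro.Tier4.Line4

end
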